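import Summits.QuantumFields.BalabanUV.Beta.GAN24.LayerFrozenLabel
import Summits.QuantumFields.BalabanUV.Beta.GAN24.LayerCount

/-!
# `BalabanUV.Beta.GAN24.LayerFrozenCount` — binder row G-an2-4 / (CONV-C), W-slot CT-W, route «WC-TL» ∕ «QR-LL», row **(LT-Δ) «LAYER TRANSPORT»**, part (LT-3c) — THE FROZEN
# (CHARGED) TERM's COUNT: cubic weight × three legs FROZEN AT THE SLOT with (N1)∕(N1′)-type envelopes and unit second differences at a FREE scale `S` × per-label charge
# profiles with (M0_y), (Π_y) × the BULK label count = `S·L^{2d}` (generic `d`); in the HÖLDER-3∕2 currency of record `S = (L^{d+3}·√L)⁻¹` this is `L^{2d}·(L^{d+3}√L)⁻¹`,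
# `(√L)⁻¹` at `d = 3` (the OWNER gan24-p1 g26's W11 (2), journal l.40372: «with `π_y = 0` as well the pairing is second order in the slot leg» — and RULING
# R-gan24p1-g26-3, l.40711: the commissioned (N1″) `S = (L^{d+4})⁻¹` (net `L^{d−4}`) is WITHDRAWN as a theorem target after leaf-02 g54's located `log L`
# (R-leaf02-g54-1, l.40650); leaf-02's (N1″)_{1∕2} ∕ «N1-TAYLOR» currency `(L^{d+3}·√L)⁻¹` (l.40778) adopted; «any NET exponent < 0 closes (DUH)»)

NOT IN PRINT; OUR BOOKKEEPING ([folklore] file 1 `LayerFrozenLabel` label by label ⨾ `LayerPushFrozenSlice.leg_rel_sup` ⨾ `LayerCount.sum_exp_quo_le_card` ⨾ exponent arithmetic; G-an2-4 formalisation swarm, leaf prover `b2b-balaban-gan24-formalise-leaf-01`, gen 63 ∕ re-cut gen 64).  HONEST FRAMING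
(cell contract, verbatim): «discharging `BetaPertH` makes Bałaban's UV stability UNCONDITIONAL — a real constructive-QFT result; it is NOT the continuum limit and NOT the Clay
problem.»  HONEST DEPENDENCY (verbatim): «continuum YM on T⁴ ⇐ BetaPertH ∧ nine spine estimates (0/9 proved); BetaPertH ⇐ (D1) ∧ (D4) ∧ CAP+tail; G-an2-4 gates asym, D1 and
NE2/3/4.»

## What (generic `d`; GENERIC slot functions given by envelopes — no object of an2's typed system occurs; file 2 of 2: §0–§2 — the frozen leg product and ONE label's pairing
## `abs_frozen_label_le` under (M0_y), (Π_y) — are file 1 `GAN24/LayerFrozenLabel`, split off for the gate's size cap, statements unchanged)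
§3 `ledger_pow_frozen` (`L^{3(d+1)}·(S·(L^{d+2})⁻²)·L^{d+1} = S·L^{2d}`), `pow_pattern_le` (the two-gradient pattern `(L^{d+3})⁻²(L^{d+2})⁻¹ = (L^{d+4})⁻¹(L^{d+2})⁻²` is dominated
   as soon as `(L^{d+4})⁻¹ ≤ S`), `inv_pow_le_inv_pow_sqrt` (`(L^{d+4})⁻¹ ≤ (L^{d+3}√L)⁻¹` at `L ≥ 1`),
   **`abs_cubic_frozen_le`**: legs with sup `A·(L^{d+2})⁻¹`, unit gradient `A′·(L^{d+3})⁻¹` (the `ℓ¹` shapes of (N1), (N1′) `RespStepDecay.exists_respStep_decay_and_grad`), unit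
   second differences `A″·S`, ANY `S ≥ (L^{d+4})⁻¹`; per-label profiles `Z_y` (`y ∈ T`, `|Z_y e| ≤ B e^{−δ‖e−y‖₁}`, (M0_y), (Π_y), labels within `ρ` coarse labels of `Y`,
   `|T| ≤ CT·L^{d+1}`) ⇒ `|L^{3(d+1)}·Σ_{y∈T} Σ'_e a e·b e·c e·Z_y e| ≤ K·CT·(S·L^{2d})·e^{−(κ∕4)(‖cx−cU‖₁+‖cz−cU‖₁)}·e^{−(κ∕2)‖Y−cU‖₁}`, `K` FREE OF `L` AND `S`;
   **`abs_cubic_frozen_le_half`** (`S = (L^{d+3}√L)⁻¹` ⇒ `L^{2d}·(L^{d+3}√L)⁻¹`), **`abs_cubic_frozen_three_half`**: `d = 3` ⇒ `(√L)⁻¹`.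
WITH `LayerTransportCount.abs_cubic_push₃_sub_frozen_layer_le` (the remainder half, `L^{d−4}`) THIS COMPLETES THE GENERIC (LT-3) LEDGER for legs GIVEN BY ENVELOPES: remainder `L^{d−4}`
+ frozen `S·L^{2d}` (`(√L)⁻¹` at `d = 3` in the currency of record) — both NET exponents negative at `d = 3`.  WHAT IT IS NOT: the legs of the literal are DRESSED
(`respStep + dz λ`, seams — journal R-leaf01-g63-5, K-LL-4; (LT-3b) := the slot∕kernel Ward identity, R-gan24p1-g26-2); (N1″)_{1∕2} is leaf-02 g54's (staged, not yet a tree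
theorem; its decay is in `supNorm (quo …)`, an `ℓ∞ → ℓ¹` rate adapter is the instantiation file's); (M0_y)∕(Π_y) for the σ-letters are the CHARGE AUDIT's (E15: hold for the
combined `Ψ_j` at `j = 0, 1` on SDF-1).  [folklore]; 0 cited facts, 0 `def`, 0 `def … : Prop`, 0 sorry.  NEVER «G-an2-4 closed» as (CONV-C); NOT D1, NOT `BetaPertH`, NOT
continuum, NOT Clay.  2026-08-22.
-/

noncomputable section

open Finset
open scoped BigOperators
open Literature.MathematicalPhysics.QuantumFieldTheory
open Literature.MathematicalPhysics.QuantumFieldTheory.Balaban1983to89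
open Literature.MathematicalPhysics.QuantumFieldTheory.Balaban1983to89.Beta
open B12Sec2to5 (l1 l1_nonneg)
open ExpKernelCalculus (Site Zl Zl_nonneg Zl_pos summable_exp_shift' tsum_exp_shift' l1_sub_triangle l1_sub_symm)
open LatticeForm (quo)
open Summit.QuantumFields.BalabanUV.Beta.GAN24.LatticeFreeze (abs_sub_le_of_unit_steps)
open Summit.QuantumFields.BalabanUV.Beta.GAN24.LayerPushFrozenSlice (exp_wobble leg_rel_sup)
open Summit.QuantumFields.BalabanUV.Beta.GAN24.LayerPushMoments (abs_tsum_mul_le_of_moments abs_second_diff_mul_le abs_diff_mul_le)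
open Summit.QuantumFields.BalabanUV.Beta.GAN24.LayerCount (sum_exp_quo_le_card)
open Summit.QuantumFields.BalabanUV.Beta.GAN24 (LayerPushEntry.exp_three_le)

open Summit.QuantumFields.BalabanUV.Beta.GAN24.LayerFrozenLabel (leg_rel_grad leg_rel_second abs_frozen_label_le)

namespace Summit.QuantumFields.BalabanUV.Beta.GAN24.LayerFrozenCount

variable {d : ℕ}

/-! ## §3 The count: cubic weight × three legs with a FREE second-difference scale `S` × the label count = `S·L^{2d}` -/

/-- [folklore] **THE FROZEN-TERM LEDGER with a free second-difference scale `S`**: `L^{3(d+1)}·(S·(L^{d+2})⁻¹·(L^{d+2})⁻¹)·L^{d+1} = S·L^{2d}` —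
cubic weight, one second-difference monomial pattern `S·(L^{d+2})⁻²`, and the BULK label count `L^{d+1}`.  (`S = (L^{d+4})⁻¹` would read `L^{d−4}`;
`S = (L^{d+3}·√L)⁻¹` reads `L^{2d}·(L^{d+3}·√L)⁻¹`, i.e. `(√L)⁻¹` at `d = 3`.) -/
theorem ledger_pow_frozen (L : ℝ) (hL : L ≠ 0) (S : ℝ) (d : ℕ) :
    L ^ (3 * (d + 1)) * (S * (L ^ (d + 2))⁻¹ * (L ^ (d + 2))⁻¹) * L ^ (d + 1) = S * L ^ (2 * d) := by
  field_simp
  ring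

/-- [folklore] The two-gradient power pattern is the commissioned second-difference pattern: `(L^{d+3})⁻¹(L^{d+3})⁻¹(L^{d+2})⁻¹ = (L^{d+4})⁻¹(L^{d+2})⁻¹(L^{d+2})⁻¹`;
hence it is dominated by `S·(L^{d+2})⁻¹·(L^{d+2})⁻¹` as soon as `(L^{d+4})⁻¹ ≤ S`. -/
theorem pow_pattern_le (L : ℝ) (hL : 0 < L) {S : ℝ} (d : ℕ) (hS : (L ^ (d + 4))⁻¹ ≤ S) :
    (L ^ (d + 3))⁻¹ * (L ^ (d + 3))⁻¹ * (L ^ (d + 2))⁻¹ ≤ S * (L ^ (d + 2))⁻¹ * (L ^ (d + 2))⁻¹ := by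
  have e : (L ^ (d + 3))⁻¹ * (L ^ (d + 3))⁻¹ * (L ^ (d + 2))⁻¹ = (L ^ (d + 4))⁻¹ * (L ^ (d + 2))⁻¹ * (L ^ (d + 2))⁻¹ := by
    field_simp; ring
  rw [e]
  have h0 : 0 ≤ (L ^ (d + 2))⁻¹ * (L ^ (d + 2))⁻¹ := by positivity
  calc (L ^ (d + 4))⁻¹ * (L ^ (d + 2))⁻¹ * (L ^ (d + 2))⁻¹ = (L ^ (d + 4))⁻¹ * ((L ^ (d + 2))⁻¹ * (L ^ (d + 2))⁻¹) := by ring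
    _ ≤ S * ((L ^ (d + 2))⁻¹ * (L ^ (d + 2))⁻¹) := mul_le_mul_of_nonneg_right hS h0
    _ = _ := by ring

/-- [folklore] The HÖLDER-3∕2 scale dominates the commissioned one at `L ≥ 1`: `(L^{d+4})⁻¹ ≤ (L^{d+3}·√L)⁻¹`. -/
theorem inv_pow_le_inv_pow_sqrt (L : ℝ) (hL : 1 ≤ L) (d : ℕ) : (L ^ (d + 4))⁻¹ ≤ (L ^ (d + 3) * Real.sqrt L)⁻¹ := by
  have hL0 : 0 < L := by linarith
  have hs : Real.sqrt L ≤ L := by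
    have h1 : Real.sqrt L * 1 ≤ Real.sqrt L * Real.sqrt L :=
      mul_le_mul_of_nonneg_left (by rw [show (1:ℝ) = Real.sqrt 1 from Real.sqrt_one.symm]; exact Real.sqrt_le_sqrt hL) (Real.sqrt_nonneg _)
    rw [mul_one, Real.mul_self_sqrt hL0.le] at h1
    exact h1
  have hs0 : 0 < Real.sqrt L := Real.sqrt_pos.2 hL0
  rw [inv_le_inv₀ (by positivity) (by positivity), show d + 4 = (d + 3) + 1 from rfl, pow_succ L (d + 3)]
  exact mul_le_mul_of_nonneg_left hs (by positivity)
section Count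

variable {a b c : (Fin (d + 1) → ℤ) → ℝ} {Zy : (Fin (d + 1) → ℤ) → (Fin (d + 1) → ℤ) → ℝ} {T : Finset (Fin (d + 1) → ℤ)}
  {L : ℕ} {κ δ A A' A'' S B ρ : ℝ} {cU cx cz Y : Fin (d + 1) → ℤ}

/-- NOT IN PRINT; OUR BOOKKEEPING (§2 label by label ⨾ `pow_pattern_le` ⨾ `LayerCount.sum_exp_quo_le_card` ⨾ `ledger_pow_frozen`).
**(LT-3c) THE FROZEN (CHARGED) TERM's COUNT — GENERIC `d`, FREE SECOND-DIFFERENCE SCALE `S`**: at relative blocking `L ≥ 1`, three slot functions (the table leg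
and the two kernel legs frozen AT THE SLOT) with coarse envelopes — sup `A·(L^{d+2})⁻¹`, unit gradient `A′·(L^{d+3})⁻¹` (the `ℓ¹` shapes of (N1) ∕ (N1′)), unit second
differences `A″·S` with ANY scale `S ≥ (L^{d+4})⁻¹` (the OWNER gan24-p1 g26's RULING R-gan24p1-g26-3, journal l.40711: the commissioned (N1″) `S = (L^{d+4})⁻¹` is
WITHDRAWN as a theorem target after leaf-02 g54's located `log L` (R-leaf02-g54-1, l.40650); leaf-02's HÖLDER currency `S = (L^{d+3}·√L)⁻¹` ((N1″)_{1∕2}, l.40778) is the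
one of record — «keep the exponent as a hypothesis and let the instantiation file choose»), each times `e^{−κ‖quo L · − c‖₁}` about its own coarse point (`cU`, `cx`, `cz`);
a charge profile that is a SUM OVER LABELS `y ∈ T` of per-label profiles `Z_y` localised at `y` (`|Z_y e| ≤ B·e^{−δ‖e−y‖₁}`, `4κ < δ`) with ZERO TOTAL (M0_y) and ZERO
SLOT-DIPOLE (Π_y) EACH, all labels within `ρ` coarse labels of `Y`, `|T| ≤ CT·L^{d+1}`.  Then
`|L^{3(d+1)}·Σ_{y∈T} Σ'_e a e·b e·c e·Z_y e| ≤ K · CT · (S·L^{2d}) · e^{−(κ∕4)(‖cx−cU‖₁+‖cz−cU‖₁)}·e^{−(κ∕2)‖Y−cU‖₁}`,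
`K = K₃(A,A′,A″,κ)·B·(8∕(δ−4κ)²)·Zl((δ−4κ)∕4)·e^{(κ∕2)ρ}` FREE OF `L` AND OF `S` — the pairing is second order in the legs ((M0_y), (Π_y) eat the sup-only and
single-gradient monomials; the two-gradient monomials `(L^{d+3})⁻²(L^{d+2})⁻¹` are dominated through `pow_pattern_le`). -/
theorem abs_cubic_frozen_le (hL : 1 ≤ L) (hκ : 0 < κ) (hκδ : 4 * κ < δ) (hA : 0 ≤ A) (hA' : 0 ≤ A') (hA'' : 0 ≤ A'') (hB : 0 ≤ B) {CT : ℝ}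
    (hS : (((L : ℝ)) ^ (d + 4))⁻¹ ≤ S)
    (ha0 : ∀ u, |a u| ≤ A * (((L : ℝ)) ^ (d + 2))⁻¹ * Real.exp (-κ * l1 (quo L u - cU)))
    (ha1 : ∀ u i, |a (u + Pi.single i 1) - a u| ≤ A' * (((L : ℝ)) ^ (d + 3))⁻¹ * Real.exp (-κ * l1 (quo L u - cU)))
    (ha2 : ∀ u i j, |(a (u + Pi.single i 1 + Pi.single j 1) - a (u + Pi.single j 1)) - (a (u + Pi.single i 1) - a u)|
      ≤ A'' * S * Real.exp (-κ * l1 (quo L u - cU)))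
    (hb0 : ∀ u, |b u| ≤ A * (((L : ℝ)) ^ (d + 2))⁻¹ * Real.exp (-κ * l1 (quo L u - cx)))
    (hb1 : ∀ u i, |b (u + Pi.single i 1) - b u| ≤ A' * (((L : ℝ)) ^ (d + 3))⁻¹ * Real.exp (-κ * l1 (quo L u - cx)))
    (hb2 : ∀ u i j, |(b (u + Pi.single i 1 + Pi.single j 1) - b (u + Pi.single j 1)) - (b (u + Pi.single i 1) - b u)|
      ≤ A'' * S * Real.exp (-κ * l1 (quo L u - cx)))
    (hc0 : ∀ u, |c u| ≤ A * (((L : ℝ)) ^ (d + 2))⁻¹ * Real.exp (-κ * l1 (quo L u - cz)))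
    (hc1 : ∀ u i, |c (u + Pi.single i 1) - c u| ≤ A' * (((L : ℝ)) ^ (d + 3))⁻¹ * Real.exp (-κ * l1 (quo L u - cz)))
    (hc2 : ∀ u i j, |(c (u + Pi.single i 1 + Pi.single j 1) - c (u + Pi.single j 1)) - (c (u + Pi.single i 1) - c u)|
      ≤ A'' * S * Real.exp (-κ * l1 (quo L u - cz)))
    (hZ : ∀ y ∈ T, ∀ e, |Zy y e| ≤ B * Real.exp (-δ * l1 (e - y)))
    (hM0 : ∀ y ∈ T, ∑' e, Zy y e = 0) (hP1 : ∀ y ∈ T, ∀ i : Fin (d + 1), ∑' e, (((e - y) i : ℤ) : ℝ) * Zy y e = 0)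
    (hT : ∀ y ∈ T, l1 (quo L y - Y) ≤ ρ) (hTcard : (T.card : ℝ) ≤ CT * (L : ℝ) ^ (d + 1)) :
    |(L : ℝ) ^ (3 * (d + 1)) * ∑ y ∈ T, ∑' e, (a e * b e * c e) * Zy y e|
      ≤ ((((A'' * A * A + 2 * A' * A' * A + A * A'' * A) * Real.exp (2 * κ) + 2 * ((A' * A + A * A') * Real.exp κ) * A' + A * A * A'')
            * Real.exp (2 * (2 * κ))) * B * (8 / (δ - 2 * (2 * κ)) ^ 2 * Zl (d + 1) ((δ - 2 * (2 * κ)) / 4)) * Real.exp ((κ / 2) * ρ) * CT)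
        * (S * (L : ℝ) ^ (2 * d))
        * Real.exp (-(κ / 4) * (l1 (cx - cU) + l1 (cz - cU))) * Real.exp (-(κ / 2) * l1 (Y - cU)) := by
  have hL0 : (0 : ℝ) < (L : ℝ) := by exact_mod_cast hL
  have hLne : (L : ℝ) ≠ 0 := hL0.ne'
  have hκ0 := hκ.le
  set P2 : ℝ := (((L : ℝ)) ^ (d + 2))⁻¹ with hP2
  set P3 : ℝ := (((L : ℝ)) ^ (d + 3))⁻¹ with hP3
  set Q : ℝ := S * P2 * P2 with hQ
  have hP2p : 0 < P2 := by positivity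
  have hP3p : 0 < P3 := by positivity
  have hS0 : 0 ≤ S := le_trans (by positivity) hS
  have hpat : P3 * P3 * P2 ≤ Q := pow_pattern_le (L : ℝ) hL0 d hS
  obtain ⟨α, hα⟩ : ∃ α : ℝ, α = (A'' * A * A + A * A'' * A) * Real.exp (2 * κ) + A * A * A'' := ⟨_, rfl⟩
  obtain ⟨β, hβ⟩ : ∃ β : ℝ, β = 2 * A' * A' * A * Real.exp (2 * κ) + 2 * ((A' * A + A * A') * Real.exp κ) * A' := ⟨_, rfl⟩
  set K₃ : ℝ := ((A'' * A * A + 2 * A' * A' * A + A * A'' * A) * Real.exp (2 * κ) + 2 * ((A' * A + A * A') * Real.exp κ) * A' + A * A * A'')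
            * Real.exp (2 * (2 * κ)) with hK₃
  have hαβ : (α + β) * Real.exp (2 * (2 * κ)) = K₃ := by rw [hα, hβ, hK₃]; ring
  have hα0 : 0 ≤ α := by rw [hα]; positivity
  have hβ0 : 0 ≤ β := by rw [hβ]; positivity
  set M₂ : ℝ := 8 / (δ - 2 * (2 * κ)) ^ 2 * Zl (d + 1) ((δ - 2 * (2 * κ)) / 4) with hM₂
  have hM₂0 : 0 ≤ M₂ := by have := Zl_nonneg (D := d + 1) (by linarith : (0:ℝ) < (δ - 2 * (2 * κ)) / 4); positivity
  -- envelopes at the label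
  set Ea : (Fin (d + 1) → ℤ) → ℝ := fun y => Real.exp (-κ * l1 (quo L y - cU)) with hEa
  set Eb : (Fin (d + 1) → ℤ) → ℝ := fun y => Real.exp (-κ * l1 (quo L y - cx)) with hEb
  set Ec : (Fin (d + 1) → ℤ) → ℝ := fun y => Real.exp (-κ * l1 (quo L y - cz)) with hEc
  -- per label
  have hlabel : ∀ y ∈ T, |∑' e, (a e * b e * c e) * Zy y e| ≤ K₃ * Q * (Ea y * Eb y * Ec y) * B * M₂ := by
    intro y hy
    have h := abs_frozen_label_le (a := a) (b := b) (c := c) (Z := Zy y) (y := y) (κ := κ) (δ := δ) (B := B)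
      (pa := A * P2 * Ea y) (ga := A' * P3 * Ea y) (ha := A'' * S * Ea y)
      (pb := A * P2 * Eb y) (gb := A' * P3 * Eb y) (hb := A'' * S * Eb y)
      (pc := A * P2 * Ec y) (gc := A' * P3 * Ec y) (hc := A'' * S * Ec y)
      hκ0 hκδ (by positivity) (by positivity) (by positivity) (by positivity) (by positivity) (by positivity)
      (by positivity) (by positivity) (by positivity)
      (fun p => leg_rel_sup hL hκ0 (by positivity) (f := fun (_ : Fin (d + 1)) u => a u) (fun _ u => ha0 u) y 0 p)
      (fun p i => leg_rel_grad hL hκ0 (by positivity) (f := a) ha1 y p i)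
      (fun p i j => leg_rel_second hL hκ0 (by positivity) (f := a) ha2 y p i j)
      (fun p => leg_rel_sup hL hκ0 (by positivity) (f := fun (_ : Fin (d + 1)) u => b u) (fun _ u => hb0 u) y 0 p)
      (fun p i => leg_rel_grad hL hκ0 (by positivity) (f := b) hb1 y p i)
      (fun p i j => leg_rel_second hL hκ0 (by positivity) (f := b) hb2 y p i j)
      (fun p => leg_rel_sup hL hκ0 (by positivity) (f := fun (_ : Fin (d + 1)) u => c u) (fun _ u => hc0 u) y 0 p)
      (fun p i => leg_rel_grad hL hκ0 (by positivity) (f := c) hc1 y p i)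
      (fun p i j => leg_rel_second hL hκ0 (by positivity) (f := c) hc2 y p i j)
      (hZ y hy) (hM0 y hy) (hP1 y hy)
    refine h.trans ?_
    -- the power patterns: the second-difference monomials carry `S·P2·P2 = Q`, the two-gradient ones `P3·P3·P2 ≤ Q`
    have hE0 : 0 ≤ Ea y * Eb y * Ec y := by positivity
    have key : ((A'' * S * Ea y * (A * P2 * Eb y) + 2 * (A' * P3 * Ea y) * (A' * P3 * Eb y) + A * P2 * Ea y * (A'' * S * Eb y))
          * Real.exp (2 * κ) * (A * P2 * Ec y)
        + 2 * ((A' * P3 * Ea y * (A * P2 * Eb y) + A * P2 * Ea y * (A' * P3 * Eb y)) * Real.exp κ) * (A' * P3 * Ec y)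
        + A * P2 * Ea y * (A * P2 * Eb y) * (A'' * S * Ec y))
        = (α * (S * P2 * P2) + β * (P3 * P3 * P2)) * (Ea y * Eb y * Ec y) := by
      rw [hα, hβ]; ring
    have hdom : (α * (S * P2 * P2) + β * (P3 * P3 * P2)) * (Ea y * Eb y * Ec y) ≤ (α + β) * Q * (Ea y * Eb y * Ec y) := by
      have h1 : β * (P3 * P3 * P2) ≤ β * Q := mul_le_mul_of_nonneg_left hpat hβ0
      have e2 : α * (S * P2 * P2) = α * Q := by rw [hQ]
      have h2 : α * (S * P2 * P2) + β * (P3 * P3 * P2) ≤ (α + β) * Q := by rw [e2, add_mul]; exact add_le_add le_rfl h1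
      exact mul_le_mul_of_nonneg_right h2 hE0
    rw [hM₂, ← hαβ]
    calc _ = (α * (S * P2 * P2) + β * (P3 * P3 * P2)) * (Ea y * Eb y * Ec y) * Real.exp (2 * (2 * κ)) * B
              * (8 / (δ - 2 * (2 * κ)) ^ 2 * Zl (d + 1) ((δ - 2 * (2 * κ)) / 4)) := by rw [← key]
      _ ≤ (α + β) * Q * (Ea y * Eb y * Ec y) * Real.exp (2 * (2 * κ)) * B * (8 / (δ - 2 * (2 * κ)) ^ 2 * Zl (d + 1) ((δ - 2 * (2 * κ)) / 4)) := by
          have hM : 0 ≤ 8 / (δ - 2 * (2 * κ)) ^ 2 * Zl (d + 1) ((δ - 2 * (2 * κ)) / 4) := by rw [← hM₂]; exact hM₂0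
          exact mul_le_mul_of_nonneg_right (mul_le_mul_of_nonneg_right (mul_le_mul_of_nonneg_right hdom (by positivity)) hB) hM
      _ = _ := by ring
  -- the three envelopes at the label against the block leg
  have hsplit : ∀ y, Ea y * Eb y * Ec y ≤ Real.exp (-(κ / 2) * l1 (quo L y - cU)) * Real.exp (-(κ / 4) * (l1 (cx - cU) + l1 (cz - cU))) := by
    intro y
    have h := LayerPushEntry.exp_three_le (d := d) hκ0 hκ0 (quo L y) cU cx cz
    rw [min_eq_left (by linarith : κ / 4 ≤ κ)] at h
    exact h
  have hsumT : ∑ y ∈ T, Real.exp (-(κ / 2) * l1 (quo L y - cU)) ≤ (T.card : ℝ) * (Real.exp ((κ / 2) * ρ) * Real.exp (-(κ / 2) * l1 (Y - cU))) :=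
    sum_exp_quo_le_card (by positivity) T Y cU hT
  -- assemble
  rw [abs_mul, abs_of_pos (pow_pos hL0 _)]
  have hK₃0 : 0 ≤ K₃ := by rw [hK₃]; positivity
  have hQ0 : 0 ≤ Q := by rw [hQ]; positivity
  have hsum : |∑ y ∈ T, ∑' e, (a e * b e * c e) * Zy y e|
      ≤ K₃ * Q * B * M₂ * ((T.card : ℝ) * (Real.exp ((κ / 2) * ρ) * Real.exp (-(κ / 2) * l1 (Y - cU))))
        * Real.exp (-(κ / 4) * (l1 (cx - cU) + l1 (cz - cU))) := by
    calc |∑ y ∈ T, ∑' e, (a e * b e * c e) * Zy y e| ≤ ∑ y ∈ T, |∑' e, (a e * b e * c e) * Zy y e| := Finset.abs_sum_le_sum_abs _ _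
      _ ≤ ∑ y ∈ T, K₃ * Q * (Ea y * Eb y * Ec y) * B * M₂ := Finset.sum_le_sum hlabel
      _ ≤ ∑ y ∈ T, K₃ * Q * (Real.exp (-(κ / 2) * l1 (quo L y - cU)) * Real.exp (-(κ / 4) * (l1 (cx - cU) + l1 (cz - cU)))) * B * M₂ := by
          refine Finset.sum_le_sum fun y _ => ?_
          have hK : 0 ≤ K₃ * Q := mul_nonneg hK₃0 hQ0
          exact mul_le_mul_of_nonneg_right (mul_le_mul_of_nonneg_right (mul_le_mul_of_nonneg_left (hsplit y) hK) hB) hM₂0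
      _ = K₃ * Q * B * M₂ * Real.exp (-(κ / 4) * (l1 (cx - cU) + l1 (cz - cU))) * ∑ y ∈ T, Real.exp (-(κ / 2) * l1 (quo L y - cU)) := by
          rw [Finset.mul_sum]; exact Finset.sum_congr rfl fun y _ => by ring
      _ ≤ K₃ * Q * B * M₂ * Real.exp (-(κ / 4) * (l1 (cx - cU) + l1 (cz - cU)))
            * ((T.card : ℝ) * (Real.exp ((κ / 2) * ρ) * Real.exp (-(κ / 2) * l1 (Y - cU)))) :=
          mul_le_mul_of_nonneg_left hsumT (by positivity)
      _ = _ := by ring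
  have hcardL : (T.card : ℝ) * (Real.exp ((κ / 2) * ρ) * Real.exp (-(κ / 2) * l1 (Y - cU)))
      ≤ CT * (L : ℝ) ^ (d + 1) * (Real.exp ((κ / 2) * ρ) * Real.exp (-(κ / 2) * l1 (Y - cU))) :=
    mul_le_mul_of_nonneg_right hTcard (by positivity)
  calc (L : ℝ) ^ (3 * (d + 1)) * |∑ y ∈ T, ∑' e, (a e * b e * c e) * Zy y e|
      ≤ (L : ℝ) ^ (3 * (d + 1)) * (K₃ * Q * B * M₂ * (CT * (L : ℝ) ^ (d + 1) * (Real.exp ((κ / 2) * ρ) * Real.exp (-(κ / 2) * l1 (Y - cU))))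
          * Real.exp (-(κ / 4) * (l1 (cx - cU) + l1 (cz - cU)))) := by
        refine mul_le_mul_of_nonneg_left (hsum.trans ?_) (pow_pos hL0 _).le
        have hKQBM : 0 ≤ K₃ * Q * B * M₂ := mul_nonneg (mul_nonneg (mul_nonneg hK₃0 hQ0) hB) hM₂0
        exact mul_le_mul_of_nonneg_right (mul_le_mul_of_nonneg_left hcardL hKQBM) (by positivity)
    _ = _ := by
        have e := ledger_pow_frozen (L : ℝ) hLne S d
        rw [← e]
        simp only [hQ, hK₃, hM₂, hP2]
        ring

/-- NOT IN PRINT; OUR BOOKKEEPING.  **(LT-3c) IN THE HÖLDER-3∕2 CURRENCY OF RECORD** (RULING R-gan24p1-g26-3; leaf-02 g54's (N1″)_{1∕2} ∕ «N1-TAYLOR», journal l.40778):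
unit second differences `A″·(L^{d+3}·√L)⁻¹` ⇒ the frozen term nets `L^{2d}·(L^{d+3}·√L)⁻¹` (= `L^{d−3}∕√L`). -/
theorem abs_cubic_frozen_le_half (hL : 1 ≤ L) (hκ : 0 < κ) (hκδ : 4 * κ < δ) (hA : 0 ≤ A) (hA' : 0 ≤ A') (hA'' : 0 ≤ A'') (hB : 0 ≤ B) {CT : ℝ}
    (ha0 : ∀ u, |a u| ≤ A * (((L : ℝ)) ^ (d + 2))⁻¹ * Real.exp (-κ * l1 (quo L u - cU)))
    (ha1 : ∀ u i, |a (u + Pi.single i 1) - a u| ≤ A' * (((L : ℝ)) ^ (d + 3))⁻¹ * Real.exp (-κ * l1 (quo L u - cU)))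
    (ha2 : ∀ u i j, |(a (u + Pi.single i 1 + Pi.single j 1) - a (u + Pi.single j 1)) - (a (u + Pi.single i 1) - a u)|
      ≤ A'' * (((L : ℝ)) ^ (d + 3) * Real.sqrt (L : ℝ))⁻¹ * Real.exp (-κ * l1 (quo L u - cU)))
    (hb0 : ∀ u, |b u| ≤ A * (((L : ℝ)) ^ (d + 2))⁻¹ * Real.exp (-κ * l1 (quo L u - cx)))
    (hb1 : ∀ u i, |b (u + Pi.single i 1) - b u| ≤ A' * (((L : ℝ)) ^ (d + 3))⁻¹ * Real.exp (-κ * l1 (quo L u - cx)))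
    (hb2 : ∀ u i j, |(b (u + Pi.single i 1 + Pi.single j 1) - b (u + Pi.single j 1)) - (b (u + Pi.single i 1) - b u)|
      ≤ A'' * (((L : ℝ)) ^ (d + 3) * Real.sqrt (L : ℝ))⁻¹ * Real.exp (-κ * l1 (quo L u - cx)))
    (hc0 : ∀ u, |c u| ≤ A * (((L : ℝ)) ^ (d + 2))⁻¹ * Real.exp (-κ * l1 (quo L u - cz)))
    (hc1 : ∀ u i, |c (u + Pi.single i 1) - c u| ≤ A' * (((L : ℝ)) ^ (d + 3))⁻¹ * Real.exp (-κ * l1 (quo L u - cz)))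
    (hc2 : ∀ u i j, |(c (u + Pi.single i 1 + Pi.single j 1) - c (u + Pi.single j 1)) - (c (u + Pi.single i 1) - c u)|
      ≤ A'' * (((L : ℝ)) ^ (d + 3) * Real.sqrt (L : ℝ))⁻¹ * Real.exp (-κ * l1 (quo L u - cz)))
    (hZ : ∀ y ∈ T, ∀ e, |Zy y e| ≤ B * Real.exp (-δ * l1 (e - y)))
    (hM0 : ∀ y ∈ T, ∑' e, Zy y e = 0) (hP1 : ∀ y ∈ T, ∀ i : Fin (d + 1), ∑' e, (((e - y) i : ℤ) : ℝ) * Zy y e = 0)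
    (hT : ∀ y ∈ T, l1 (quo L y - Y) ≤ ρ) (hTcard : (T.card : ℝ) ≤ CT * (L : ℝ) ^ (d + 1)) :
    |(L : ℝ) ^ (3 * (d + 1)) * ∑ y ∈ T, ∑' e, (a e * b e * c e) * Zy y e|
      ≤ ((((A'' * A * A + 2 * A' * A' * A + A * A'' * A) * Real.exp (2 * κ) + 2 * ((A' * A + A * A') * Real.exp κ) * A' + A * A * A'')
            * Real.exp (2 * (2 * κ))) * B * (8 / (δ - 2 * (2 * κ)) ^ 2 * Zl (d + 1) ((δ - 2 * (2 * κ)) / 4)) * Real.exp ((κ / 2) * ρ) * CT)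
        * ((L : ℝ) ^ (2 * d) * (((L : ℝ)) ^ (d + 3) * Real.sqrt (L : ℝ))⁻¹)
        * Real.exp (-(κ / 4) * (l1 (cx - cU) + l1 (cz - cU))) * Real.exp (-(κ / 2) * l1 (Y - cU)) := by
  have hL1 : (1 : ℝ) ≤ (L : ℝ) := by exact_mod_cast hL
  have h := abs_cubic_frozen_le (S := (((L : ℝ)) ^ (d + 3) * Real.sqrt (L : ℝ))⁻¹) hL hκ hκδ hA hA' hA'' hB (inv_pow_le_inv_pow_sqrt (L : ℝ) hL1 d)
    ha0 ha1 ha2 hb0 hb1 hb2 hc0 hc1 hc2 hZ hM0 hP1 hT hTcard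
  rw [mul_comm ((((L : ℝ)) ^ (d + 3) * Real.sqrt (L : ℝ))⁻¹) ((L : ℝ) ^ (2 * d))] at h
  exact h

/-- NOT IN PRINT; OUR BOOKKEEPING.  **(LT-3c) AT `d = 3` IN THE HÖLDER-3∕2 CURRENCY: the frozen term nets `(√L)⁻¹`** — a NEGATIVE net exponent, which is what the OWNER's
(DUH) row needs («any NET exponent < 0 closes (DUH)», l.40711; ratio `Lc^{−1∕2}` on this term). -/
theorem abs_cubic_frozen_three_half {a b c : (Fin (3 + 1) → ℤ) → ℝ} {Zy : (Fin (3 + 1) → ℤ) → (Fin (3 + 1) → ℤ) → ℝ} {T : Finset (Fin (3 + 1) → ℤ)}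
    {L : ℕ} {κ δ A A' A'' B ρ : ℝ} {cU cx cz Y : Fin (3 + 1) → ℤ}
    (hL : 1 ≤ L) (hκ : 0 < κ) (hκδ : 4 * κ < δ) (hA : 0 ≤ A) (hA' : 0 ≤ A') (hA'' : 0 ≤ A'') (hB : 0 ≤ B) {CT : ℝ}
    (ha0 : ∀ u, |a u| ≤ A * (((L : ℝ)) ^ (3 + 2))⁻¹ * Real.exp (-κ * l1 (quo L u - cU)))
    (ha1 : ∀ u i, |a (u + Pi.single i 1) - a u| ≤ A' * (((L : ℝ)) ^ (3 + 3))⁻¹ * Real.exp (-κ * l1 (quo L u - cU)))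
    (ha2 : ∀ u i j, |(a (u + Pi.single i 1 + Pi.single j 1) - a (u + Pi.single j 1)) - (a (u + Pi.single i 1) - a u)|
      ≤ A'' * (((L : ℝ)) ^ (3 + 3) * Real.sqrt (L : ℝ))⁻¹ * Real.exp (-κ * l1 (quo L u - cU)))
    (hb0 : ∀ u, |b u| ≤ A * (((L : ℝ)) ^ (3 + 2))⁻¹ * Real.exp (-κ * l1 (quo L u - cx)))
    (hb1 : ∀ u i, |b (u + Pi.single i 1) - b u| ≤ A' * (((L : ℝ)) ^ (3 + 3))⁻¹ * Real.exp (-κ * l1 (quo L u - cx)))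
    (hb2 : ∀ u i j, |(b (u + Pi.single i 1 + Pi.single j 1) - b (u + Pi.single j 1)) - (b (u + Pi.single i 1) - b u)|
      ≤ A'' * (((L : ℝ)) ^ (3 + 3) * Real.sqrt (L : ℝ))⁻¹ * Real.exp (-κ * l1 (quo L u - cx)))
    (hc0 : ∀ u, |c u| ≤ A * (((L : ℝ)) ^ (3 + 2))⁻¹ * Real.exp (-κ * l1 (quo L u - cz)))
    (hc1 : ∀ u i, |c (u + Pi.single i 1) - c u| ≤ A' * (((L : ℝ)) ^ (3 + 3))⁻¹ * Real.exp (-κ * l1 (quo L u - cz)))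
    (hc2 : ∀ u i j, |(c (u + Pi.single i 1 + Pi.single j 1) - c (u + Pi.single j 1)) - (c (u + Pi.single i 1) - c u)|
      ≤ A'' * (((L : ℝ)) ^ (3 + 3) * Real.sqrt (L : ℝ))⁻¹ * Real.exp (-κ * l1 (quo L u - cz)))
    (hZ : ∀ y ∈ T, ∀ e, |Zy y e| ≤ B * Real.exp (-δ * l1 (e - y)))
    (hM0 : ∀ y ∈ T, ∑' e, Zy y e = 0) (hP1 : ∀ y ∈ T, ∀ i : Fin (3 + 1), ∑' e, (((e - y) i : ℤ) : ℝ) * Zy y e = 0)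
    (hT : ∀ y ∈ T, l1 (quo L y - Y) ≤ ρ) (hTcard : (T.card : ℝ) ≤ CT * (L : ℝ) ^ (3 + 1)) :
    |(L : ℝ) ^ (3 * (3 + 1)) * ∑ y ∈ T, ∑' e, (a e * b e * c e) * Zy y e|
      ≤ ((((A'' * A * A + 2 * A' * A' * A + A * A'' * A) * Real.exp (2 * κ) + 2 * ((A' * A + A * A') * Real.exp κ) * A' + A * A * A'')
            * Real.exp (2 * (2 * κ))) * B * (8 / (δ - 2 * (2 * κ)) ^ 2 * Zl (3 + 1) ((δ - 2 * (2 * κ)) / 4)) * Real.exp ((κ / 2) * ρ) * CT)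
        * (Real.sqrt (L : ℝ))⁻¹
        * Real.exp (-(κ / 4) * (l1 (cx - cU) + l1 (cz - cU))) * Real.exp (-(κ / 2) * l1 (Y - cU)) := by
  have h := abs_cubic_frozen_le_half (d := 3) hL hκ hκδ hA hA' hA'' hB ha0 ha1 ha2 hb0 hb1 hb2 hc0 hc1 hc2 hZ hM0 hP1 hT hTcard
  have hL0 : (0 : ℝ) < (L : ℝ) := by exact_mod_cast hL
  have hs0 : 0 < Real.sqrt (L : ℝ) := Real.sqrt_pos.2 hL0
  have hLne : (L : ℝ) ≠ 0 := hL0.ne'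
  have hsne : Real.sqrt (L : ℝ) ≠ 0 := hs0.ne'
  have e : ((L : ℝ)) ^ (2 * 3) * ((((L : ℝ)) ^ (3 + 3) * Real.sqrt (L : ℝ))⁻¹) = (Real.sqrt (L : ℝ))⁻¹ := by
    rw [mul_inv, ← mul_assoc, show (2 * 3 : ℕ) = 3 + 3 from rfl, mul_inv_cancel₀ (pow_ne_zero _ hLne), one_mul]
  rw [e] at h
  exact h

end Count

end Summit.QuantumFields.BalabanUV.Beta.GAN24.LayerFrozenCount

end
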